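import Mathlib
import Literature.NumberTheory.Transcendental.GammaFields
import Summits.Schanuel.Schanuel.Theorems.RigidCoreAclSubsetLogFreeCoreCaseIITower
import Summits.Schanuel.Schanuel.Theorems.RigidCoreAclSubsetLogFreeCoreCaseIIShift
import Summits.Schanuel.Schanuel.Theorems.RigidCoreAclSubsetLogFreeCoreCaseIIShiftZero
import Summits.Schanuel.Schanuel.Theorems.RigidCoreAclSubsetLogFreeCoreCaseIIMinpoly
import Summits.Schanuel.Schanuel.Theorems.RigidCoreAclSubsetLogFreeCoreCaseIISAK
import Summits.Schanuel.Schanuel.Theorems.RigidCoreAclSubsetLogFreeCoreCaseIIAssembly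
import Summits.Schanuel.Schanuel.Theorems.RigidCoreAclSubsetLogFreeCoreCaseIIEngine

/-!
# Case II core, file 8: the level induction
(helper file for the registered stub `stub_caseII_core` of line `eac-extends-core-automorphisms`,
crux stmt-Schanuel-0968 `Summit.Schanuel.Schanuel.Theses.RigidCore.AclSubsetLogFreeCore`)

Setting of the core claim: a strong `X ∋ τ` (`exp τ = 1`, kernel `⊆ ℤτ`), an L-step `ℓ` over `X`,
the A-extension `U = (X + ℚℓ) + ℚ(v)` in which `X` is A-closed, and its canonical level tower `Y`
(`Y 0 = X + ℚℓ`, `Y (s+1) = U ⊓ span (acl (gens (Y s)))`).  An automorphism `Θ` is ADMISSIBLE if it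
is an exponential ring automorphism fixing `X` pointwise, shifting the branch `Θ ℓ = ℓ + q τ`
(`q ≠ 0`) and stabilising `U`; positive iterates of admissible automorphisms are admissible
(`exists_admissible_iterate`).

**`level_induction`**: for every level `s` and every admissible `Θ`,
* (P)   every `Θ`-fixed element of `Y (s+1)` lies in `Y s`;
* (Rep) every non-zero `c ∈ acl (gens (Y s))` with `Θ c = exp w · c`, `w ∈ Y s`, is `c₀ · exp yₜ` with
  `yₜ ∈ Y s` and `c₀` periodic under `Θ`.
Base: level `0` of the core claim (`…CaseIIShiftZero`) and the semi-invariant affine kill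
(`…CaseIISAK`).  Step: (Mono) at level `s` from (Rep)+(P) for the iterates (`mono1_of_rep_of_fix`),
then (FixF)/(SemiF) for `K = k(exp Y (s+1))`, `k = acl (gens (Y s))` (`…CaseIIEngine`, with the
fraction facts (Frac), (Den) as hypotheses), (P) at `s+1` by `mem_of_fixed_of_isAlgebraic` and (Rep)
at `s+1` by the descent engine `semiInvariant_algebraic_eq_mul` (`…CaseIIMinpoly`).
-/

noncomputable section

set_option linter.dupNamespace false

open Set
open scoped BigOperators
open Literature.ModelTheory.ExponentialFields Literature.ModelTheory.ExponentialFields.ExponentialRing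
open Literature.NumberTheory.Transcendental Literature.NumberTheory.Transcendental.GammaField

namespace Summit.Schanuel.Schanuel.Theorems.RigidCore

namespace CaseIICore

variable {E : Type} [Field E] [CharZero E] [ExponentialRing E]

/-! ### Admissible automorphisms and their iterates -/

omit [ExponentialRing E] in
/-- Iterating the stability of `U`. [folklore] -/
theorem iterate_mem_iff (θ : E ≃+* E) {U : Submodule ℚ E} (hU : ∀ u, u ∈ U ↔ θ u ∈ U) (n : ℕ) :
    ∀ u, u ∈ U ↔ θ^[n] u ∈ U := by
  induction n with
  | zero => intro u; rfl
  | succ n ih => intro u; rw [Function.iterate_succ_apply', ← hU]; exact ih u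

/-- **Positive iterates of an admissible automorphism are admissible.** [folklore] -/
theorem exists_admissible_iterate (θ : E ≃+* E) (hθ : ∀ x, θ (exp x) = exp (θ x))
    {X : Submodule ℚ E} (hX : ∀ x ∈ X, θ x = x) {τ : E} (hτX : τ ∈ X)
    {q : ℚ} {ℓ : E} (hθℓ : θ ℓ = ℓ + q • τ) {U : Submodule ℚ E} (hU : ∀ u, u ∈ U ↔ θ u ∈ U)
    (n : ℕ) :
    ∃ ψ : E ≃+* E, (∀ x, ψ x = θ^[n] x) ∧ (∀ x, ψ (exp x) = exp (ψ x)) ∧ (∀ x ∈ X, ψ x = x) ∧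
      ψ ℓ = ℓ + ((n : ℚ) * q) • τ ∧ ∀ u, u ∈ U ↔ ψ u ∈ U := by
  obtain ⟨ψ, hψ, hψexp⟩ := exists_ringEquiv_iterate θ hθ n
  refine ⟨ψ, hψ, hψexp, fun x hx => ?_, ?_, fun u => ?_⟩
  · rw [hψ]; exact iterate_apply_eq_self θ (hX x hx) n
  · have hqτ : θ (q • τ) = q • τ := by rw [map_rat_smul, hX τ hτX]
    rw [hψ, iterate_apply_branch θ hqτ hθℓ n, mul_smul, Nat.cast_smul_eq_nsmul, nsmul_eq_mul]
  · rw [hψ]; exact iterate_mem_iff θ hU n u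

/-! ### The `Θ`-stable field `K = k(exp Y'')` -/

/-- A ring automorphism mapping `k` into `k` and `Y''` into `Y''` maps `K = k(exp Y'')` into
itself. [folklore] -/
theorem map_closure_le (φ : E ≃+* E) (hφexp : ∀ x, φ (exp x) = exp (φ x)) {k : Subfield E}
    {Y'' : Submodule ℚ E} (hφk : ∀ z ∈ k, φ z ∈ k) (hφY'' : ∀ y ∈ Y'', φ y ∈ Y'')
    {z : E} (hz : z ∈ Subfield.closure ((k : Set E) ∪ exp '' (Y'' : Set E))) :
    φ z ∈ Subfield.closure ((k : Set E) ∪ exp '' (Y'' : Set E)) := by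
  have hmap : (Subfield.closure ((k : Set E) ∪ exp '' (Y'' : Set E))).map φ.toRingHom ≤
      Subfield.closure ((k : Set E) ∪ exp '' (Y'' : Set E)) := by
    rw [RingHom.map_field_closure]
    refine Subfield.closure_le.2 ?_
    rintro _ ⟨v, hv | ⟨y, hy, rfl⟩, rfl⟩
    · exact Subfield.subset_closure (Or.inl (hφk v hv))
    · refine Subfield.subset_closure (Or.inr ⟨φ y, hφY'' y hy, ?_⟩)
      exact (hφexp y).symm
  exact hmap ⟨z, hz, rfl⟩

/-- `K = k(exp Y'')` is `θ`-stable in both directions when `k` and `Y''` are. [folklore] -/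
theorem mem_closure_iff_apply_mem (θ : E ≃+* E) (hθexp : ∀ x, θ (exp x) = exp (θ x))
    {k : Subfield E} {Y'' : Submodule ℚ E} (hθk : ∀ z, z ∈ k ↔ θ z ∈ k)
    (hθY'' : ∀ y, y ∈ Y'' ↔ θ y ∈ Y'') (z : E) :
    z ∈ Subfield.closure ((k : Set E) ∪ exp '' (Y'' : Set E)) ↔
      θ z ∈ Subfield.closure ((k : Set E) ∪ exp '' (Y'' : Set E)) := by
  have hsymmexp : ∀ x, θ.symm (exp x) = exp (θ.symm x) := fun x => by
    apply θ.injective; rw [θ.apply_symm_apply, hθexp, θ.apply_symm_apply]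
  constructor
  · exact map_closure_le θ hθexp (fun z hz => (hθk z).1 hz) (fun y hy => (hθY'' y).1 hy)
  · intro hz
    have h := map_closure_le θ.symm hsymmexp (k := k) (Y'' := Y'')
      (fun z hz => (hθk _).2 (by rw [θ.apply_symm_apply]; exact hz))
      (fun y hy => (hθY'' _).2 (by rw [θ.apply_symm_apply]; exact hy)) hz
    rwa [θ.symm_apply_apply] at h

omit [CharZero E] [ExponentialRing E] in
/-- A relatively algebraically closed subfield of an algebraically closed field is closed under
`d`-th roots. [folklore] -/
theorem exists_pow_eq_of_forall_mem [IsAlgClosed E] (k : Subfield E)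
    (hk : ∀ z, IsAlgebraic k z → z ∈ k) :
    ∀ c ∈ k, ∀ d : ℕ, 0 < d → ∃ c' ∈ k, c' ^ d = c := by
  intro c hc d hd
  obtain ⟨z, hz⟩ := IsAlgClosed.exists_pow_nat_eq c hd
  refine ⟨z, hk z ⟨Polynomial.X ^ d - Polynomial.C ⟨c, hc⟩, ?_, ?_⟩, hz⟩
  · exact (Polynomial.monic_X_pow_sub_C _ hd.ne').ne_zero
  · rw [map_sub, map_pow, Polynomial.aeval_X, Polynomial.aeval_C, hz]
    exact sub_self _

/-! ### The level induction -/

/-- **The level induction of the core claim** (see the module docstring): (P) and (Rep) at every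
level `s`, for every admissible automorphism. [folklore] -/
theorem level_induction [IsAlgClosed E]
    {τ : E} (hτ : τ ≠ 0) (hτ1 : exp τ = 1) (hker : ∀ z, exp z = 1 → ∃ m : ℤ, z = (m : ℚ) • τ)
    {X : Submodule ℚ E} (hτX : τ ∈ X) (hXs : IsStrong X)
    {ℓ : E} (hℓexp : exp ℓ ∈ acl (gens X)) (hℓ : ℓ ∉ acl (gens X))
    {U : Submodule ℚ E} {n : ℕ} (v : Fin n → E)
    (hU : U = (X ⊔ Submodule.span ℚ {ℓ}) ⊔ Submodule.span ℚ (range v))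
    (hvA : ∀ i : Fin n, v i ∈ acl (gens ((X ⊔ Submodule.span ℚ {ℓ}) ⊔ Submodule.span ℚ (v '' Set.Iio i))))
    (hXclosed : ∀ u ∈ U, u ∈ acl (gens X) → u ∈ X)
    {Y : ℕ → Submodule ℚ E} (hY0 : Y 0 = X ⊔ Submodule.span ℚ {ℓ})
    (hYs : ∀ s, Y (s + 1) = U ⊓ Submodule.span ℚ (acl (gens (Y s))))
    (hFrac : ∀ (k : Subfield E) (Y' Y'' : Submodule ℚ E) (p : ℕ) (b : Fin p → E),
      (∀ y ∈ Y'', ∃ r : Fin p → ℚ, y - ∑ i, r i • b i ∈ Y') → (∀ y ∈ Y', exp y ∈ k) →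
      ∀ z ∈ Subfield.closure ((k : Set E) ∪ exp '' (Y'' : Set E)),
        ∃ N : ℕ, 0 < N ∧ ∃ (P Q : MvPolynomial (Fin p) k), IsRelPrime P Q ∧
          MvPolynomial.aeval (fun i => exp ((1 / (N : ℚ)) • b i)) Q ≠ 0 ∧
          z * MvPolynomial.aeval (fun i => exp ((1 / (N : ℚ)) • b i)) Q =
            MvPolynomial.aeval (fun i => exp ((1 / (N : ℚ)) • b i)) P)
    (hDen : ∀ (k : Subfield E) (Y' Y'' : Submodule ℚ E) (p : ℕ) (b : Fin p → E),
      (∀ z, IsAlgebraic k z → z ∈ k) →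
      (∀ y ∈ Y'', ∃ r : Fin p → ℚ, y - ∑ i, r i • b i ∈ Y') → (∀ i, b i ∈ Y'') →
      (∀ y ∈ Y', exp y ∈ k) →
      (∀ N : ℕ, 0 < N → AlgebraicIndependent k (fun i => exp ((1 / (N : ℚ)) • b i))) →
      ∀ (θ : E ≃+* E), (∀ x, θ (exp x) = exp (θ x)) → (∀ z, z ∈ k ↔ θ z ∈ k) →
        (∀ y, y ∈ Y'' ↔ θ y ∈ Y'') →
      ∀ {N : ℕ}, 0 < N → ∀ {z : E} {P Q : MvPolynomial (Fin p) k}, IsRelPrime P Q →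
        MvPolynomial.aeval (fun i => exp ((1 / (N : ℚ)) • b i)) Q ≠ 0 →
        z * MvPolynomial.aeval (fun i => exp ((1 / (N : ℚ)) • b i)) Q =
          MvPolynomial.aeval (fun i => exp ((1 / (N : ℚ)) • b i)) P →
        ∀ {c₀ y₀ : E}, c₀ ∈ k → c₀ ≠ 0 → y₀ ∈ Y'' → θ z = (c₀ * exp y₀) * z →
        ∃ c ∈ k, c ≠ 0 ∧ ∃ y ∈ Y'',
          θ (MvPolynomial.aeval (fun i => exp ((1 / (N : ℚ)) • b i)) Q) =
            (c * exp y) * MvPolynomial.aeval (fun i => exp ((1 / (N : ℚ)) • b i)) Q)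
    (s : ℕ) :
    (∀ (Θ : E ≃+* E), (∀ x, Θ (exp x) = exp (Θ x)) → (∀ x ∈ X, Θ x = x) →
        ∀ q : ℚ, q ≠ 0 → Θ ℓ = ℓ + q • τ → (∀ u, u ∈ U ↔ Θ u ∈ U) →
        ∀ a ∈ Y (s + 1), Θ a = a → a ∈ Y s) ∧
    (∀ (Θ : E ≃+* E), (∀ x, Θ (exp x) = exp (Θ x)) → (∀ x ∈ X, Θ x = x) →
        ∀ q : ℚ, q ≠ 0 → Θ ℓ = ℓ + q • τ → (∀ u, u ∈ U ↔ Θ u ∈ U) →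
        ∀ c ∈ acl (gens (Y s)), c ≠ 0 → ∀ w ∈ Y s, Θ c = exp w * c →
          ∃ c₀ yt : E, yt ∈ Y s ∧ c = c₀ * exp yt ∧ ∃ M : ℕ, 0 < M ∧ Θ^[M] c₀ = c₀) := by
  classical
  -- the tower data
  have hV : IsStrong (X ⊔ Submodule.span ℚ {ℓ}) := isStrong_base hXs hℓexp hℓ
  have hVU : X ⊔ Submodule.span ℚ {ℓ} ≤ U := by rw [hU]; exact le_sup_left
  have hfg : IsFG (X ⊔ Submodule.span ℚ {ℓ}) U := by
    rw [hU, isFG_sup_left]; exact isFG_span_of_finite _ (finite_range v)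
  have hY0' : Y 0 = X ⊔ Submodule.span ℚ {ℓ} := hY0
  have hℓY : ∀ s, ℓ ∈ Y s := fun s => base_le_tower hVU hY0' hYs s
    (Submodule.mem_sup_right (Submodule.mem_span_singleton_self ℓ))
  have hXY : ∀ s, X ≤ Y s := fun s => le_trans le_sup_left (base_le_tower hVU hY0' hYs s)
  -- stability of the tower under admissible automorphisms
  have hstab : ∀ (Θ : E ≃+* E), (∀ x, Θ (exp x) = exp (Θ x)) → (∀ x ∈ X, Θ x = x) →
      ∀ q : ℚ, Θ ℓ = ℓ + q • τ → (∀ u, u ∈ U ↔ Θ u ∈ U) → ∀ s u, u ∈ Y s ↔ Θ u ∈ Y s := by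
    intro Θ hΘexp hΘX q hΘℓ hΘU s
    exact (map_eq_iff_forall_mem_iff Θ).1 (map_tower_eq Θ hΘexp hY0' hYs
      (map_base_eq Θ hΘX hτX q hΘℓ) ((map_eq_iff_forall_mem_iff Θ).2 hΘU) s)
  -- transversality of the tower
  have hLog : ∀ s, ∀ w ∈ U, exp w ∈ acl (gens (Y s)) → w ∈ Y s := fun s w hw hexp =>
    mem_tower_of_exp_mem_acl hV hfg hVU hY0' hYs v hU hvA s hw hexp
  induction s with
  | zero =>
    refine ⟨fun Θ hΘexp hΘX q hq hΘℓ _ a ha hfix => ?_, fun Θ hΘexp hΘX q _ hΘℓ _ c hc hc0 w hw hsemi => ?_⟩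
    · exact mem_towerZero_of_fixed Θ hΘexp hΘX hτX hτ hq hΘℓ hℓexp hℓ hXclosed hY0' hYs ha hfix
    · rw [hY0'] at hc hw
      obtain ⟨M, hM, hMc⟩ := exists_iterate_apply_eq_self_of_semiInvariant Θ hΘexp hΘX hτX hτ1 hΘℓ
        hℓexp hℓ hc hc0 hw hsemi
      exact ⟨c, 0, (Y 0).zero_mem, by rw [exp_zero, mul_one], M, hM, hMc⟩
  | succ s ih =>
    obtain ⟨ihP, ihRep⟩ := ih
    /- level data: `k = acl (gens (Y s))`, `Y' = Y s`, `Y'' = Y (s+1)`, a basis `b` of `Y''` mod `Y'` -/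
    obtain ⟨k, hkcoe⟩ := CaseIILstep.exists_subfield_coe_eq_acl (gens (Y s))
    have hkmem : ∀ z, z ∈ k ↔ z ∈ acl (gens (Y s)) := fun z => by rw [← SetLike.mem_coe, hkcoe]
    have hk : ∀ z, IsAlgebraic k z → z ∈ k := fun z hz =>
      (hkmem z).2 (mem_acl_of_isAlgebraic_subfield k hkcoe hz)
    have hkroot := exists_pow_eq_of_forall_mem k hk
    have hYsStrong : IsStrong (Y s) := tower_isStrong hV hfg hVU hY0' hYs s
    have hfgs : IsFG (Y s) (Y (s + 1)) :=
      (hfg.of_le_left (base_le_tower hVU hY0' hYs s)).mono (tower_le hVU hY0' hYs (s + 1))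
    obtain ⟨p, b, hbY, hbspan, hblin⟩ := exists_basis_mod hfgs
    have hbacl : ∀ i, b i ∈ acl (gens (Y s)) := fun i => ((mem_tower_succ_iff hYs).1 (hbY i)).2
    have hexpY' : ∀ y ∈ Y s, exp y ∈ k := fun y hy => (hkmem _).2 (subset_acl _ (exp_mem_gens hy))
    have hAI : ∀ N : ℕ, 0 < N → AlgebraicIndependent k (fun i => exp ((1 / (N : ℚ)) • b i)) :=
      fun N hN => algebraicIndependent_level k hYsStrong hkcoe b hbacl hblin hN
    have hY'le : Y s ≤ Y (s + 1) := le_tower_succ hVU hY0' hYs s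
    have hLogs : ∀ w ∈ Y (s + 1), exp w ∈ k → w ∈ Y s := fun w hw hexp =>
      hLog s w (tower_le hVU hY0' hYs (s + 1) hw) ((hkmem _).1 hexp)
    -- the subfield `K = k(exp Y'')` contains `gens (Y (s+1))`
    set K : Subfield E := Subfield.closure ((k : Set E) ∪ exp '' (Y (s + 1) : Set E)) with hKdef
    have hgensK : gens (Y (s + 1)) ⊆ (K : Set E) := by
      rintro z (hz | ⟨y, hy, rfl⟩)
      · exact Subfield.subset_closure (Or.inl ((hkmem z).2 ((mem_tower_succ_iff hYs).1 hz).2))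
      · exact Subfield.subset_closure (Or.inr ⟨y, hy, rfl⟩)
    have halgK : ∀ a ∈ acl (gens (Y (s + 1))), IsAlgebraic K a := fun a ha =>
      isAlgebraic_subfield_of_mem_acl K hgensK ha
    /- per admissible `Θ`: stability data, (Mono), (FixF), (SemiF) -/
    have level : ∀ (Θ : E ≃+* E), (∀ x, Θ (exp x) = exp (Θ x)) → (∀ x ∈ X, Θ x = x) →
        ∀ q : ℚ, q ≠ 0 → Θ ℓ = ℓ + q • τ → (∀ u, u ∈ U ↔ Θ u ∈ U) →
        (∀ z, z ∈ k ↔ Θ z ∈ k) ∧ (∀ y, y ∈ Y (s + 1) ↔ Θ y ∈ Y (s + 1)) ∧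
        (∀ z, z ∈ K ↔ Θ z ∈ K) ∧
        (∀ z ∈ K, Θ z = z → z ∈ k) ∧
        (∀ z ∈ K, z ≠ 0 → ∀ {c₀ y₀ : E}, c₀ ∈ k → c₀ ≠ 0 → y₀ ∈ Y (s + 1) →
          Θ z = (c₀ * exp y₀) * z → ∃ c ∈ k, ∃ y ∈ Y (s + 1), z = c * exp y) := by
      intro Θ hΘexp hΘX q hq hΘℓ hΘU
      have hΘY : ∀ s u, u ∈ Y s ↔ Θ u ∈ Y s := hstab Θ hΘexp hΘX q hΘℓ hΘU
      have hΘY' : ∀ y, y ∈ Y s ↔ Θ y ∈ Y s := hΘY s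
      have hΘY'' : ∀ y, y ∈ Y (s + 1) ↔ Θ y ∈ Y (s + 1) := hΘY (s + 1)
      have hΘk : ∀ z, z ∈ k ↔ Θ z ∈ k := fun z => by
        rw [hkmem, hkmem]
        exact apply_mem_aclGens_iff Θ hΘexp ((map_eq_iff_forall_mem_iff Θ).2 hΘY') z
      have hΘK : ∀ z, z ∈ K ↔ Θ z ∈ K := mem_closure_iff_apply_mem Θ hΘexp hΘk hΘY''
      -- (Mono) at level `s` for `Θ`: through the admissible iterates
      have hMono : ∀ m : ℕ, 0 < m → ∀ c ∈ k, c ≠ 0 → ∀ y ∈ Y (s + 1), y ∉ Y s →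
          Θ^[m] (c * exp y) ≠ c * exp y := by
        intro m hm c hc hc0 y hy hyY' hfix
        obtain ⟨ψ, hψ, hψexp, hψX, hψℓ, hψU⟩ := exists_admissible_iterate Θ hΘexp hΘX hτX hΘℓ hΘU m
        have hmq : ((m : ℚ) * q) ≠ 0 := mul_ne_zero (by exact_mod_cast hm.ne') hq
        have hψY : ∀ s u, u ∈ Y s ↔ ψ u ∈ Y s := hstab ψ hψexp hψX _ hψℓ hψU
        have hψk : ∀ z, z ∈ k ↔ ψ z ∈ k := fun z => by
          rw [hkmem, hkmem]
          exact apply_mem_aclGens_iff ψ hψexp ((map_eq_iff_forall_mem_iff ψ).2 (hψY s)) z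
        -- (Rep) and (FixIter) for `ψ` from the induction hypothesis
        have hRep : ∀ c ∈ k, c ≠ 0 → ∀ w ∈ Y s, ψ c = exp w * c →
            ∃ c₀ yt : E, yt ∈ Y s ∧ c = c₀ * exp yt ∧ ∃ M : ℕ, 0 < M ∧ ψ^[M] c₀ = c₀ :=
          fun c hc hc0 w hw hsemi => ihRep ψ hψexp hψX _ hmq hψℓ hψU c ((hkmem c).1 hc) hc0 w hw hsemi
        have hFixIter : ∀ M : ℕ, 0 < M → ∀ u ∈ Y (s + 1), ψ^[M] u = u → u ∈ Y s := by
          intro M hM u hu hfixu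
          obtain ⟨ψ', hψ', hψ'exp, hψ'X, hψ'ℓ, hψ'U⟩ :=
            exists_admissible_iterate ψ hψexp hψX hτX hψℓ hψU M
          have hMq : ((M : ℚ) * ((m : ℚ) * q)) ≠ 0 := mul_ne_zero (by exact_mod_cast hM.ne') hmq
          exact ihP ψ' hψ'exp hψ'X _ hMq hψ'ℓ hψ'U u hu (by rw [hψ']; exact hfixu)
        have hψτ : ψ τ = τ := hψX τ hτX
        have key := mono1_of_rep_of_fix k ψ hψexp hψk (hψY (s + 1)) hY'le hψτ hker (hℓY s) hmq hψℓ
          hRep hLogs hFixIter c hc hc0 y hy (by rw [hψ]; exact hfix)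
        exact hyY' key
      -- (Frac), (Den) at this level
      have hFrac' := hFrac k (Y s) (Y (s + 1)) p b hbspan hexpY'
      have hDen' := @hDen k (Y s) (Y (s + 1)) p b hk hbspan hbY hexpY' hAI Θ hΘexp hΘk hΘY''
      refine ⟨hΘk, hΘY'', hΘK, fun z hz hfix => ?_, fun z hz hz0 c₀ y₀ hc₀ hc₀0 hy₀ hsemi => ?_⟩
      · exact mem_of_fixed k b hbspan hblin hbY hexpY' hAI Θ hΘexp hΘk hΘY' hΘY'' hFrac'
          (fun hN _ _ _ hrel hQ hz _ _ hc₀ hc₀0 hy₀ hsemi => hDen' hN hrel hQ hz hc₀ hc₀0 hy₀ hsemi)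
          hMono hz hfix
      · exact exists_eq_const_mul_exp_of_semiInvariant k b hbspan hblin hbY hexpY' hAI Θ hΘexp hΘk
          hΘY' hΘY'' hFrac'
          (fun hN _ _ _ hrel hQ hz _ _ hc₀ hc₀0 hy₀ hsemi => hDen' hN hrel hQ hz hc₀ hc₀0 hy₀ hsemi)
          hMono hz hz0 hc₀ hc₀0 hy₀ hsemi
    refine ⟨fun Θ hΘexp hΘX q hq hΘℓ hΘU a ha hfix => ?_,
      fun Θ hΘexp hΘX q hq hΘℓ hΘU c hc hc0 w hw hsemi => ?_⟩
    · /- (P) at level `s+1` -/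
      obtain ⟨-, -, hΘK, hFixF, -⟩ := level Θ hΘexp hΘX q hq hΘℓ hΘU
      obtain ⟨haU, haacl⟩ := (mem_tower_succ_iff hYs).1 ha
      have hak : a ∈ k := mem_of_fixed_of_isAlgebraic Θ K k hΘK hk hFixF (halgK a haacl) hfix
      exact (mem_tower_succ_iff hYs).2 ⟨haU, (hkmem a).1 hak⟩
    · /- (Rep) at level `s+1` -/
      obtain ⟨hΘk, hΘY'', hΘK, hFixF, hSemiF⟩ := level Θ hΘexp hΘX q hq hΘℓ hΘU
      -- the monomials `exp (Y (s+1))`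
      set Mon : Set E := {m | ∃ y ∈ Y (s + 1), m = exp y} with hMon
      have hMonK : Mon ⊆ K := by
        rintro _ ⟨y, hy, rfl⟩; exact Subfield.subset_closure (Or.inr ⟨y, hy, rfl⟩)
      have hMon0 : ∀ m ∈ Mon, m ≠ 0 := by rintro _ ⟨y, _, rfl⟩; exact exp_ne_zero _
      have hMonpow : ∀ m ∈ Mon, ∀ n : ℕ, m ^ n ∈ Mon := by
        rintro _ ⟨y, hy, rfl⟩ n
        exact ⟨n • y, (Y (s + 1)).smul_of_tower_mem n hy, (exp_nsmul n y).symm⟩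
      have hMonroot : ∀ m ∈ Mon, ∀ d : ℕ, 0 < d → ∃ m' ∈ Mon, m' ^ d = m := by
        rintro _ ⟨y, hy, rfl⟩ d hd
        refine ⟨exp ((1 / (d : ℚ)) • y), ⟨_, (Y (s + 1)).smul_mem _ hy, rfl⟩, ?_⟩
        rw [← exp_nsmul, ← Nat.cast_smul_eq_nsmul ℚ, smul_smul,
          mul_one_div_cancel (by exact_mod_cast hd.ne'), one_smul]
      have hSemiF' : ∀ z ∈ K, z ≠ 0 → ∀ u ∈ Mon, Θ z = u * z → ∃ c ∈ k, ∃ m ∈ Mon, z = c * m := by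
        rintro z hz hz0 _ ⟨y, hy, rfl⟩ hsz
        obtain ⟨c, hc, y', hy', rfl⟩ := hSemiF z hz hz0 k.one_mem one_ne_zero hy (by rw [one_mul]; exact hsz)
        exact ⟨c, hc, exp y', ⟨y', hy', rfl⟩, rfl⟩
      -- the descent engine
      have hcK : IsAlgebraic K c := halgK c hc
      have hwMon : exp w ∈ Mon := ⟨w, hw, rfl⟩
      obtain ⟨c', hc', _, ⟨y', hy', rfl⟩, hceq⟩ := semiInvariant_algebraic_eq_mul Θ K k hΘK hk hkroot
        Mon hMonK hMon0 hMonpow hMonroot hFixF hSemiF' hcK hc0 hwMon hsemi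
      have hc'0 : c' ≠ 0 := by rintro rfl; exact hc0 (by rw [hceq, zero_mul])
      -- `c'` is semi-invariant with multiplier `exp w'`, `w' = w + y' - Θ y' ∈ Y s`
      set w' : E := w + y' - Θ y' with hw'
      have hΘc' : Θ c' = exp w' * c' := by
        have h1 : Θ c = Θ c' * exp (Θ y') := by rw [hceq, map_mul, hΘexp]
        rw [hsemi, hceq] at h1
        -- `exp w * (c' * exp y') = Θ c' * exp (Θ y')`
        have h2 : Θ c' = exp w * c' * exp y' * (exp (Θ y'))⁻¹ := by
          rw [← mul_assoc] at h1
          rw [h1, mul_assoc, mul_inv_cancel₀ (exp_ne_zero _), mul_one]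
        rw [h2, hw', sub_eq_add_neg, exp_add, exp_add, exp_neg_eq_inv]; ring
      have hw'Y'' : w' ∈ Y (s + 1) :=
        (Y (s + 1)).sub_mem ((Y (s + 1)).add_mem hw hy') ((hΘY'' y').1 hy')
      have hexpw' : exp w' ∈ k := by
        have h1 : exp w' = Θ c' * c'⁻¹ := by rw [hΘc', mul_assoc, mul_inv_cancel₀ hc'0, mul_one]
        rw [h1]; exact mul_mem ((hΘk c').1 hc') (inv_mem hc')
      have hw'Y' : w' ∈ Y s := hLogs w' hw'Y'' hexpw'
      obtain ⟨c₀, yt, hyt, hc'eq, M, hM, hMc₀⟩ :=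
        ihRep Θ hΘexp hΘX q hq hΘℓ hΘU c' ((hkmem c').1 hc') hc'0 w' hw'Y' hΘc'
      refine ⟨c₀, yt + y', (Y (s + 1)).add_mem (hY'le hyt) hy', ?_, M, hM, hMc₀⟩
      rw [hceq, hc'eq, exp_add]; ring

end CaseIICore

/-! ### Registered helper (crux stub list of stmt-Schanuel-0968) -/

/-- **Registered form of `CaseIICore.level_induction`** (all binders explicit): (P) and (Rep) at
every level of the canonical tower, for every admissible automorphism. [folklore] -/
theorem caseII_level_induction {E : Type} [Field E] [CharZero E] [ExponentialRing E] [IsAlgClosed E]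
    {τ : E} (hτ : τ ≠ 0) (hτ1 : exp τ = 1) (hker : ∀ z, exp z = 1 → ∃ m : ℤ, z = (m : ℚ) • τ)
    {X : Submodule ℚ E} (hτX : τ ∈ X) (hXs : IsStrong X)
    {ℓ : E} (hℓexp : exp ℓ ∈ acl (gens X)) (hℓ : ℓ ∉ acl (gens X))
    {U : Submodule ℚ E} {n : ℕ} (v : Fin n → E)
    (hU : U = (X ⊔ Submodule.span ℚ {ℓ}) ⊔ Submodule.span ℚ (range v))
    (hvA : ∀ i : Fin n, v i ∈ acl (gens ((X ⊔ Submodule.span ℚ {ℓ}) ⊔ Submodule.span ℚ (v '' Set.Iio i))))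
    (hXclosed : ∀ u ∈ U, u ∈ acl (gens X) → u ∈ X)
    {Y : ℕ → Submodule ℚ E} (hY0 : Y 0 = X ⊔ Submodule.span ℚ {ℓ})
    (hYs : ∀ s, Y (s + 1) = U ⊓ Submodule.span ℚ (acl (gens (Y s))))
    (hFrac : ∀ (k : Subfield E) (Y' Y'' : Submodule ℚ E) (p : ℕ) (b : Fin p → E),
      (∀ y ∈ Y'', ∃ r : Fin p → ℚ, y - ∑ i, r i • b i ∈ Y') → (∀ y ∈ Y', exp y ∈ k) →
      ∀ z ∈ Subfield.closure ((k : Set E) ∪ exp '' (Y'' : Set E)),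
        ∃ N : ℕ, 0 < N ∧ ∃ (P Q : MvPolynomial (Fin p) k), IsRelPrime P Q ∧
          MvPolynomial.aeval (fun i => exp ((1 / (N : ℚ)) • b i)) Q ≠ 0 ∧
          z * MvPolynomial.aeval (fun i => exp ((1 / (N : ℚ)) • b i)) Q =
            MvPolynomial.aeval (fun i => exp ((1 / (N : ℚ)) • b i)) P)
    (hDen : ∀ (k : Subfield E) (Y' Y'' : Submodule ℚ E) (p : ℕ) (b : Fin p → E),
      (∀ z, IsAlgebraic k z → z ∈ k) →
      (∀ y ∈ Y'', ∃ r : Fin p → ℚ, y - ∑ i, r i • b i ∈ Y') → (∀ i, b i ∈ Y'') →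
      (∀ y ∈ Y', exp y ∈ k) →
      (∀ N : ℕ, 0 < N → AlgebraicIndependent k (fun i => exp ((1 / (N : ℚ)) • b i))) →
      ∀ (θ : E ≃+* E), (∀ x, θ (exp x) = exp (θ x)) → (∀ z, z ∈ k ↔ θ z ∈ k) →
        (∀ y, y ∈ Y'' ↔ θ y ∈ Y'') →
      ∀ {N : ℕ}, 0 < N → ∀ {z : E} {P Q : MvPolynomial (Fin p) k}, IsRelPrime P Q →
        MvPolynomial.aeval (fun i => exp ((1 / (N : ℚ)) • b i)) Q ≠ 0 →
        z * MvPolynomial.aeval (fun i => exp ((1 / (N : ℚ)) • b i)) Q =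
          MvPolynomial.aeval (fun i => exp ((1 / (N : ℚ)) • b i)) P →
        ∀ {c₀ y₀ : E}, c₀ ∈ k → c₀ ≠ 0 → y₀ ∈ Y'' → θ z = (c₀ * exp y₀) * z →
        ∃ c ∈ k, c ≠ 0 ∧ ∃ y ∈ Y'',
          θ (MvPolynomial.aeval (fun i => exp ((1 / (N : ℚ)) • b i)) Q) =
            (c * exp y) * MvPolynomial.aeval (fun i => exp ((1 / (N : ℚ)) • b i)) Q)
    (s : ℕ) :
    (∀ (Θ : E ≃+* E), (∀ x, Θ (exp x) = exp (Θ x)) → (∀ x ∈ X, Θ x = x) →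
        ∀ q : ℚ, q ≠ 0 → Θ ℓ = ℓ + q • τ → (∀ u, u ∈ U ↔ Θ u ∈ U) →
        ∀ a ∈ Y (s + 1), Θ a = a → a ∈ Y s) ∧
    (∀ (Θ : E ≃+* E), (∀ x, Θ (exp x) = exp (Θ x)) → (∀ x ∈ X, Θ x = x) →
        ∀ q : ℚ, q ≠ 0 → Θ ℓ = ℓ + q • τ → (∀ u, u ∈ U ↔ Θ u ∈ U) →
        ∀ c ∈ acl (gens (Y s)), c ≠ 0 → ∀ w ∈ Y s, Θ c = exp w * c →
          ∃ c₀ yt : E, yt ∈ Y s ∧ c = c₀ * exp yt ∧ ∃ M : ℕ, 0 < M ∧ Θ^[M] c₀ = c₀) :=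
  CaseIICore.level_induction hτ hτ1 hker hτX hXs hℓexp hℓ v hU hvA hXclosed hY0 hYs hFrac hDen s

end Summit.Schanuel.Schanuel.Theorems.RigidCore
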